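import Summits.AtomisticToContinuum.FouriersLaw.Theses.BondHeatUncertainty
import Literature.Probability.Entropy.FluctuationTheoremUncertainty

/-!
# Sketch — crux-ideate stmt-AtomisticToContinuum-9122 (`LinearResponseFTUR`, (★)), round 1, ideator 3

First lemmas of the two idea cards, typed over existing declarations (nothing proved here except
the elementary Gram step; `sorry`-free: statements are `def … : Prop`, the Gram step is a theorem).

* Card `equilibrium-odd-score-gram` (lever B): (★) = Cauchy–Schwarz in `L²` of the EQUILIBRIUM
  stationary process against the explicit antisymmetric score
  `A_t = ½[h(x_0) - h(Θ x_t)] + (1/4T²)[g(x_t) - g(x_0) + ∫₀ᵗ k(x_s) ds]`,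
  `g = (p_0² - p_{N-1}²)/2`, `k = p_0 ∂_{q_0}Φ - p_{N-1} ∂_{q_{N-1}}Φ`, `h` the static score of the NESS
  family at `δ = 0`; the two Gram identities `⟪Q_t, A_t⟫ = G t`, `‖A_t‖² = ‖h_odd‖² + G t/(2T²)`.
  Decls: `gram_to_ftur` (PROVED: the composition step), `EquilibriumReversibility` (model-level input (α)),
  `ResponseIdentityODE` (identity (i) reduced to the semigroup ODE facts), `NormIdentityODE` (identity (ii) likewise),
  `StaticOddScoreBound` (the static input `2‖h_odd‖² ≤ liminf KL/δ²` in abstract form).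
* Card `localised-girsanov-fisher-balance` (lever 2'): the route's finite-`δ` HVV line made rigorous by
  computing the path entropy over the localising filtration and identifying the rate with the static
  Fisher form. Decls: `StaticEntropyBalance` (entropy production in Fisher form = entropy flux, model level),
  `FiniteBiasFTUR` (the finite-`δ` transfer target C⁺, typed without path space through the NESS kernel).
-/

namespace Summit.AtomisticToContinuum.FouriersLaw.Cruxes.LinearResponseFTUR.Sketch3

open scoped BigOperators NNReal ENNReal
open MeasureTheory Filter Set
open Literature.MathematicalPhysics.KineticTheory.HeatConduction

/-! ## Card B — `equilibrium-odd-score-gram` -/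

/-- The composition step of lever B (PROVED): in any real inner-product space, two vectors `Q, A` with
`⟪Q, A⟫ = G t`, `‖A‖² = n + G t/(2T²)`, `n ≤ K/2` (and `‖Q‖² = V`) satisfy the crux inequality
`2 G² t² ≤ V (G t/T² + K)` and `0 ≤ G` follows from `‖A‖² ≥ 0` for all `t` (here: one `t` gives the
inequality; positivity of `G` is `norm_nonneg` as `t → ∞`, recorded separately in the card). -/
theorem gram_to_ftur {E : Type*} [NormedAddCommGroup E] [InnerProductSpace ℝ E]
    (Q A : E) (G t T K n : ℝ) (hT : 0 < T) (_ht : 0 ≤ t) (_hG : 0 ≤ G) (hn : n ≤ K / 2)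
    (hQA : inner ℝ Q A = G * t) (hA : ‖A‖ ^ 2 = n + G * t / (2 * T ^ 2)) :
    2 * G ^ 2 * t ^ 2 ≤ ‖Q‖ ^ 2 * (G * t / T ^ 2 + K) := by
  have hcs : (G * t) ^ 2 ≤ ‖Q‖ ^ 2 * ‖A‖ ^ 2 := by
    have h1 : |inner ℝ Q A| ≤ ‖Q‖ * ‖A‖ := abs_real_inner_le_norm Q A
    have h2 : (inner ℝ Q A) ^ 2 ≤ (‖Q‖ * ‖A‖) ^ 2 := by
      calc (inner ℝ Q A) ^ 2 = |inner ℝ Q A| ^ 2 := (sq_abs _).symm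
        _ ≤ (‖Q‖ * ‖A‖) ^ 2 := by
            exact pow_le_pow_left₀ (abs_nonneg _) h1 2
    rw [hQA] at h2
    nlinarith [h2]
  rw [hA] at hcs
  have hQ : 0 ≤ ‖Q‖ ^ 2 := sq_nonneg _
  have hT2 : 0 < T ^ 2 := by positivity
  have key : ‖Q‖ ^ 2 * (n + G * t / (2 * T ^ 2)) ≤ ‖Q‖ ^ 2 * (K / 2 + G * t / (2 * T ^ 2)) :=
    mul_le_mul_of_nonneg_left (by linarith) hQ
  have : 2 * (K / 2 + G * t / (2 * T ^ 2)) = G * t / T ^ 2 + K := by field_simp; ring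
  nlinarith [hcs, key, this]

/-- (α) **Equilibrium reversibility of the constructed kernel process under Gibbs ∘ momentum flip**
(model-level input of lever B; UNPROVED in tree — the sibling crux card `bath-bond-deficit-integral`
needs the same): at equal bath temperatures the two-time law of the stationary chain is invariant under
time reversal composed with `Θ(q,p) = (q,-p)`: `∫ f · (κ_t g) dμ_T = ∫ (g∘Θ) · (κ_t (f∘Θ)) dμ_T`,
i.e. `Θ κ_t Θ = κ_t^*` in `L²(μ_T)`. Stated for bounded measurable `f, g` (extension to `L²` by density). -/
def EquilibriumReversibility : Prop :=
  ∀ ω₂ lam β γ : ℝ, 0 < ω₂ → 0 < lam → 0 < β → 0 < γ → ∀ (N : ℕ) (T : ℝ), 0 < T →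
    ∀ (t : ℝ≥0) (f g : PhaseSpace N → ℝ), Measurable f → Measurable g →
      (∃ C, ∀ x, |f x| ≤ C) → (∃ C, ∀ x, |g x| ≤ C) →
      (let P := pinnedChain ω₂ lam β γ
       let Θ : PhaseSpace N → PhaseSpace N := fun x => (x.1, -x.2)
       ∫ z, f z * (∫ y, g y ∂(P.transitionKernel N T T t z)) ∂(P.gibbsMeasure N T) =
         ∫ z, g (Θ z) * (∫ y, f (Θ y) ∂(P.transitionKernel N T T t z)) ∂(P.gibbsMeasure N T))

/-- **Identity (i) of lever B reduced to ODE facts about three equilibrium correlation functions.**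
With `a r = ⟨h, κ_r j_b⟩_{μ_T}`, `b r = ⟨g, κ_r j_b⟩`, `c r = ⟨k, κ_r j_b⟩` the line supplies:
`a' = -(γ/T²) b` (weak response equation `L* h = -(γ/T²) g` + Kolmogorov), `b' = c - 2γ b`
(`L* g = k - 2γ g` from `L g = -k - 2γ g` and (α)), `a 0 = G` (`⟨h, j_b⟩ = D_N/(N-1)`), `b 0 = 0`
(parity). CONCLUSION: `⟪Q_t, A_t⟫ = ∫₀ᵗ a + (1/4T²)(-2∫₀ᵗ b + 2∫₀ᵗ (t-r) c r dr) = G t`.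
(Elementary: the left side `Φ` has `Φ'' = 0`, `Φ' 0 = G`, `Φ 0 = 0`.) -/
def ResponseIdentityODE : Prop :=
  ∀ (γ T G : ℝ) (a b c : ℝ → ℝ), 0 < T →
    Continuous a → Continuous b → Continuous c →
    (∀ r, 0 ≤ r → HasDerivAt a (-(γ / T ^ 2) * b r) r) →
    (∀ r, 0 ≤ r → HasDerivAt b (c r - 2 * γ * b r) r) →
    a 0 = G → b 0 = 0 →
    ∀ t, 0 ≤ t →
      (∫ r in (0 : ℝ)..t, a r) +
          (1 / (4 * T ^ 2)) * (-2 * (∫ r in (0 : ℝ)..t, b r) + 2 * ∫ r in (0 : ℝ)..t, (t - r) * c r) =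
        G * t

/-- **Identity (ii) of lever B reduced to ODE facts.** With the equilibrium autocorrelations
`a t = ⟨g, κ_t g⟩`, `b t = ⟨g, κ_t k⟩ (= -⟨k, κ_t g⟩)`, `c t = ⟨k, κ_t k⟩` (so `a' = -b - 2γa`,
`b' = c - 2γb`, `a 0 = ‖g‖² = T²`, `b 0 = 0`) and the score correlations `hg t = ⟨h, κ_t g⟩`,
`hk t = ⟨h, κ_t k⟩`, `hh t = ⟨κ_t (h∘Θ), h⟩` obeying `hg' = -(γ/T²) a`, `hk' = -(γ/T²) b`,
`hh' = -(γ/T²) hg` (weak response equation) with `hg 0 = ½ - G/γ`, `hk 0 = 2G` (linearised contact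
formula `⟨p_0²⟩ = T_L - J/γ` and energy balance at the bath sites) and `hh 0 = ‖h‖² - 2 n`
(`n = ‖h_odd‖²`): the squared norm
`‖A_t‖² = ½(‖h‖² - hh t) + (1/2T²)(hg t - hg 0 + ∫₀ᵗ hk) + (1/16T⁴)(2T² - 2 a t - 4∫₀ᵗ b + 2∫₀ᵗ(t-r) c)`
equals `n + G t/(2T²)`. (Verified by hand: the defect `β` has `β 0 = 0`, `β' ≡ 0`.) -/
def NormIdentityODE : Prop :=
  ∀ (γ T G n hnorm : ℝ) (a b c hg hk hh : ℝ → ℝ), 0 < T → 0 < γ →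
    Continuous a → Continuous b → Continuous c → Continuous hg → Continuous hk → Continuous hh →
    (∀ r, 0 ≤ r → HasDerivAt a (-b r - 2 * γ * a r) r) →
    (∀ r, 0 ≤ r → HasDerivAt b (c r - 2 * γ * b r) r) →
    (∀ r, 0 ≤ r → HasDerivAt hg (-(γ / T ^ 2) * a r) r) →
    (∀ r, 0 ≤ r → HasDerivAt hk (-(γ / T ^ 2) * b r) r) →
    (∀ r, 0 ≤ r → HasDerivAt hh (-(γ / T ^ 2) * hg r) r) →
    a 0 = T ^ 2 → b 0 = 0 → hg 0 = 1 / 2 - G / γ → hk 0 = 2 * G → hh 0 = hnorm - 2 * n →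
    ∀ t, 0 ≤ t →
      (1 / 2) * (hnorm - hh t) + (1 / (2 * T ^ 2)) * (hg t - hg 0 + ∫ r in (0 : ℝ)..t, hk r) +
          (1 / (16 * T ^ 4)) *
            (2 * T ^ 2 - 2 * a t - 4 * (∫ r in (0 : ℝ)..t, b r) + 2 * ∫ r in (0 : ℝ)..t, (t - r) * c r) =
        n + G * t / (2 * T ^ 2)

/-- **The static input of lever B, abstract form** (`2‖h_odd‖² ≤ liminf KL(μ_δ ‖ Θ_*μ_δ)/δ²`):
a family `μ δ` of probability measures, weakly differentiable at `0` along bounded measurable test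
functions with score `h ∈ L²(μ 0)` (`∫ ψ dμ_δ = ∫ ψ dμ_0 + δ ∫ ψ h dμ_0 + o(δ)`) and converging in total
variation, with `μ 0` invariant under the measurable involution `Θ`; then for every bounded measurable
`Θ`-odd `ψ`: `liminf_{δ→0} KL(μ_δ ‖ Θ_*μ_δ)/δ² ≥ 2∫ψ h dμ_0 - ½∫ψ² dμ_0` (Donsker–Varadhan with the test
`δψ`; the supremum over `ψ` is `2‖h_odd‖²`). -/
def StaticOddScoreBound : Prop :=
  ∀ {Ω : Type} [MeasurableSpace Ω] (μ : ℝ → Measure Ω) (Θ : Ω → Ω) (h : Ω → ℝ),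
    (∀ δ, IsProbabilityMeasure (μ δ)) → Measurable Θ → (∀ x, Θ (Θ x) = x) →
    (μ 0).map Θ = μ 0 → MemLp h 2 (μ 0) →
    (∀ ψ : Ω → ℝ, Measurable ψ → (∃ C, ∀ x, |ψ x| ≤ C) →
        Tendsto (fun δ : ℝ => ((∫ x, ψ x ∂(μ δ)) - (∫ x, ψ x ∂(μ 0)) - δ * ∫ x, ψ x * h x ∂(μ 0)) / δ)
          (nhdsWithin 0 {(0 : ℝ)}ᶜ) (nhds 0)) →
    (∀ s : Set Ω, MeasurableSet s → Tendsto (fun δ => (μ δ s).toReal) (nhds 0) (nhds ((μ 0 s).toReal))) →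
    ∀ ψ : Ω → ℝ, Measurable ψ → (∃ C, ∀ x, |ψ x| ≤ C) → (∀ x, ψ (Θ x) = -ψ x) →
      ∀ K : ℝ, (∀ᶠ δ in nhdsWithin (0 : ℝ) {(0 : ℝ)}ᶜ,
          InformationTheory.klDiv (μ δ) ((μ δ).map Θ) ≤ ENNReal.ofReal (K * δ ^ 2)) →
        2 * (∫ x, ψ x * h x ∂(μ 0)) - (1 / 2) * ∫ x, ψ x ^ 2 ∂(μ 0) ≤ K

/-! ## Card 2' — `localised-girsanov-fisher-balance` -/

/-- **Static entropy balance (entropy production in Fisher form = entropy flux)** for a steady state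
with a smooth positive Lebesgue density `ρ` of the `N`-site chain (`N ≥ 2`) between baths at `T_L, T_R`:
`γ Σ_{i ∈ {0, N-1}} T_i ∫ (∂_{p_i} log ρ + p_i/T_i)² dμ = J (1/T_R - 1/T_L)`, `J = totalCurrent/(N-1)`
— one integration by parts in the stationary Fokker–Planck equation (multiply `L†ρ = 0` by `log ρ + H/T_i`
locally at each bath); printed for this model class in Maes–Netočný–Verschuere 2003 (heat conduction
networks) and Eckmann–Pillet–Rey-Bellet 1999b (their reservoirs). Gives clause (a) `D_N ≥ 0` at once and is
the rate in `E Σ_t = σ_δ t + KL(μ_δ ‖ Θ_*μ_δ)`. Integrability side conditions are part of the statement. -/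
def StaticEntropyBalance : Prop :=
  ∀ ω₂ lam β γ : ℝ, 0 < ω₂ → 0 < lam → 0 < β → 0 < γ → ∀ (N : ℕ), 2 ≤ N → ∀ (T_L T_R : ℝ), 0 < T_L → 0 < T_R →
    ∀ (μ : Measure (PhaseSpace N)) (ρ : PhaseSpace N → ℝ),
      (pinnedChain ω₂ lam β γ).IsSteadyState N T_L T_R μ →
      μ = volume.withDensity (fun x => ENNReal.ofReal (ρ x)) →
      ContDiff ℝ ⊤ ρ → (∀ x, 0 < ρ x) →
      (∀ i : Fin N, Integrable (fun x => (partialP i (fun y => Real.log (ρ y)) x) ^ 2) μ) →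
      Integrable (fun x => ((pinnedChain ω₂ lam β γ).hamiltonian N x) ^ 2) μ →
      γ * (∑ i : Fin N,
            ((if i.val = 0 then T_L * ∫ x, (partialP i (fun y => Real.log (ρ y)) x + x.2 i / T_L) ^ 2 ∂μ else 0) +
             (if i.val = N - 1 then T_R * ∫ x, (partialP i (fun y => Real.log (ρ y)) x + x.2 i / T_R) ^ 2 ∂μ else 0)))
        = ((pinnedChain ω₂ lam β γ).totalCurrent μ / ((N : ℝ) - 1)) * (1 / T_R - 1 / T_L)

/-- **Finite-bias FTUR (the transfer target C⁺ of card 2'), typed without path space.** Under weak-NESS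
uniqueness, along a steady-state family `μ`, for `N ≥ 2`, a bond `b`, `t > 0` and small `δ ≠ 0` with
`KL(μ_δ ‖ Θ_*μ_δ) < ∞`: writing `J = totalCurrent(μ_δ)/(N-1)` (`= E_δ Q_t / t`),
`σ_δ = J (1/(T-δ/2) - 1/(T+δ/2))` and `W_δ(t) = 2∫₀ᵗ (t-s) ∫ (j_b - J)·(κ^δ_s (j_b - J)) dμ_δ ds`
(`= Var_δ(Q_t)` for the stationary NESS process with the constructed kernel at `T ± δ/2`):
`(J t)² ≤ ½ W_δ(t) (exp(σ_δ t + KL) - 1)` — Hasegawa–Van Vu at finite `δ` with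
`⟨Σ_t⟩ = σ_δ t + KL(μ_δ ‖ Θ_*μ_δ)`. Dividing by `δ²` and letting `δ → 0` gives (★)(b); `σ_δ ≥ 0` gives (a). -/
def FiniteBiasFTUR : Prop :=
  ∀ ω₂ lam β γ : ℝ, 0 < ω₂ → 0 < lam → 0 < β → 0 < γ →
    (∀ (N : ℕ) (T_L T_R : ℝ), 0 < T_L → 0 < T_R → ∀ μ ν : Measure (PhaseSpace N),
      (pinnedChain ω₂ lam β γ).IsSteadyState N T_L T_R μ → (pinnedChain ω₂ lam β γ).IsSteadyState N T_L T_R ν → μ = ν) →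
    ∀ μ : (N : ℕ) → ℝ → ℝ → Measure (PhaseSpace N),
      (∀ (N : ℕ) (T_L T_R : ℝ), 0 < T_L → 0 < T_R → (pinnedChain ω₂ lam β γ).IsSteadyState N T_L T_R (μ N T_L T_R)) →
    ∀ T : ℝ, 0 < T → ∀ N : ℕ, 2 ≤ N → ∀ b : ℕ, ∀ hb : b + 1 < N, ∀ t : ℝ, 0 < t →
      ∀ᶠ δ in nhdsWithin (0 : ℝ) {(0 : ℝ)}ᶜ,
        (let P := pinnedChain ω₂ lam β γ
         let μδ := μ N (T + δ / 2) (T - δ / 2)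
         let J : ℝ := P.totalCurrent μδ / ((N : ℝ) - 1)
         let σ : ℝ := J * (1 / (T - δ / 2) - 1 / (T + δ / 2))
         let jc : PhaseSpace N → ℝ := fun z => P.bondCurrent N ⟨b, by omega⟩ z - J
         let Cδ : ℝ → ℝ := fun s => ∫ z, jc z * (∫ y, jc y ∂(P.transitionKernel N (T + δ / 2) (T - δ / 2) s.toNNReal z)) ∂μδ
         let W : ℝ := 2 * ∫ s in (0 : ℝ)..t, (t - s) * Cδ s
         let KL := InformationTheory.klDiv μδ (μδ.map (fun x : PhaseSpace N => (x.1, -x.2)))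
         KL ≠ ⊤ → (J * t) ^ 2 ≤ (1 / 2) * W * (Real.exp (σ * t + KL.toReal) - 1))


/-! ## Card 3 — `lebesgue-duality-friction-flip` -/

/-- **Sliced Novikov bound** (the one estimate that makes the friction ↔ anti-friction Girsanov
density of card 3 a true martingale, Karatzas–Shreve Cor. 3.5.14 on slices of length `ε`): the
time-integrated kinetic energy of the thermostatted momenta has an exponential moment of order
`γ/T_L + γ/T_R` over a short slice, controlled by `e^{ϑH(x)}` — from the in-tree exponential bound
(3.4) `E_x e^{ϑH(x_s)} ≤ e^{ϑH(x)} e^{Cs}` (`lintegral_exp_mul_hamiltonian_pinnedChainSemigroup_le`)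
and Jensen in `s`. Typed through the solution map `solMap` under the Wiener pair. -/
def SlicedNovikovBound : Prop :=
  ∀ ω₂ lam β γ : ℝ, 0 < ω₂ → 0 < lam → 0 < β → 0 < γ → ∀ (N : ℕ) (T_L T_R : ℝ), 0 < T_L → 0 < T_R →
    ∀ ϑ : ℝ, 0 < ϑ → ϑ < 1 / max T_L T_R →
      ∃ ε C : ℝ, 0 < ε ∧ 0 < C ∧ ∀ x : PhaseSpace N,
        ∫⁻ w, ENNReal.ofReal (Real.exp ((γ / T_L + γ / T_R) *
              ∫ s in (0 : ℝ)..ε, ‖((pinnedChain ω₂ lam β γ).solMap N T_L T_R s x w).2‖ ^ 2))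
            ∂Literature.Probability.Process.wienerPair
          ≤ ENNReal.ofReal (C * Real.exp (ϑ * (pinnedChain ω₂ lam β γ).hamiltonian N x))

/-- **Path-level Lebesgue duality with momentum flip, cylinder form** (card 3, first structural
stub; the two-time case without flip is `LangevinChainReversal.compProd_langevinKernel_eq`):
for the forward flow `Φ` of the chain with friction `γ` and the flow `Φ⁺` of the chain with
ANTI-friction `-γ` driven by the sign-flipped noise, Lebesgue initial measure and every bounded
measurable `F` of two path points,
`∫dx E[F(Θ Φ_t(x,B), Θ Φ_{t-s}(x,B))] = e^{2γt} ∫dy E[F(y, Φ⁺_s(y,B))]` (`0 ≤ s ≤ t`): time reversal ∘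
flip of the Lebesgue path measure is `e^{2γt}` times the anti-friction Lebesgue path measure
(pathwise: `x ↦ Φ_t(x,B)` is a bijection with Jacobian `e^{-2γt}`, inverted by the reversed flow
driven by the reversed pair, `ConfinedFlowReversal`/`ConfinedFlowJacobian`/`BrownianPairReversal`). -/
def FlippedLebesgueDuality : Prop :=
  ∀ ω₂ lam β γ : ℝ, 0 < ω₂ → 0 < lam → 0 < β → 0 < γ → ∀ (N : ℕ) (T_L T_R : ℝ), 0 < T_L → 0 < T_R →
    ∀ (t s : ℝ), 0 ≤ s → s ≤ t → ∀ F : PhaseSpace N × PhaseSpace N → ℝ, Measurable F → (∃ C, ∀ z, |F z| ≤ C) →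
      Integrable (fun z : PhaseSpace N × PhaseSpace N => F z) ((volume : Measure (PhaseSpace N)).prod volume) →
      (let P := pinnedChain ω₂ lam β γ
       let Pa := pinnedChain ω₂ lam β (-γ)
       let Θ : PhaseSpace N → PhaseSpace N := fun x => (x.1, -x.2)
       let cL := Real.sqrt (2 * γ * T_L)
       let cR := Real.sqrt (2 * γ * T_R)
       ∫ x, (∫ w, F (Θ (P.solMap N T_L T_R t x w), Θ (P.solMap N T_L T_R (t - s) x w))
              ∂Literature.Probability.Process.wienerPair) =
         Real.exp (2 * γ * t) *
           ∫ y, (∫ w, F (y, Pa.chainFlow N y (chainNoise N (-cL) (-cR) w) s)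
              ∂Literature.Probability.Process.wienerPair))

/-- Sanity link: the vendored engine of card 2' is in tree and PROVED. -/
example : Literature.Probability.Entropy.HasegawaVanVu2019_FTUR :=
  Literature.Probability.Entropy.HasegawaVanVu2019_FTUR_holds

end Summit.AtomisticToContinuum.FouriersLaw.Cruxes.LinearResponseFTUR.Sketch3
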